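import Mathlib
import Literature.NumberTheory.EllipticCurves.ThreeIsogeny

/-!
# Rank-2 observatory — KERNEL-3ISO B2: `ker α̂ ⊆ φ(E(ℚ))`, the `Ê`-side Kummer containment (explicit)

HONEST FRAMING: per-curve certified theorems and census instruments; no claim on BSD in rank ≥ 2.

For `E = E_{m,s} : y² = x³ + (mx + s)²` with Vélu quotient `Ê : Y² = X³ + m²X² − 18msX − (27s² + 16m³s)`
(`IsVeluThreePair m s E Ê`), write `x̂ = X + 4m²/3`, `b̂ = (27s − 4m³)/9`, so that
`Ê : Y² = x̂³ − 3(m x̂ + b̂)²` [cite: Cohen2007NumberTheoryI, §8.4.2]. The `Ê`-side `3`-descent map is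
`α̂(Q) = Y − θ(m x̂ + b̂) ∈ K^*/K^{*3}`, `K = ℚ(θ)`, `θ² = −3`.

**Cohen, Prop. 8.4.4 (2) ⇐ with Lemma 8.4.5, made explicit and `θ`-free**: if
`α̂(Q) = (u + vθ)³` with `u, v ∈ ℚ`, i.e.
`u³ − 9uv² = Y` and `3u²v − 3v³ = −(m x̂ + b̂)`, then `Q = φ(R)` for the RATIONAL point
`R = (x, ux)`, `x = u² − (v − 2m/3)²` of `E` (`mem_range_pointHom_of_cube`). The proof is pure algebra:
`(u² + 3v²)³ = x̂³` forces `u² + 3v² = x̂` (cube roots are unique in `ℚ`), then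
`s = −(v + m/3)·x` (Lemma 8.4.5 (3)), `R ∈ E(ℚ)`, and Vélu's formulas give `φ(R) = Q`.
No field `K` is needed for this direction; the per-curve certificates feed it the coordinates
`(u, v)` of a cube root read off in `K`. Def-free.
-/

set_option linter.dupNamespace false

noncomputable section

open scoped Classical

open WeierstrassCurve

namespace Summit.BirchSwinnertonDyer.BirchSwinnertonDyer.Rank2Observatory.ThreeIso

open Literature.NumberTheory.EllipticCurves

/-- `N(γ³) = N(γ)³` for `γ = u + vθ`, `θ² = -3`, written rationally. -/
theorem norm_cube_identity {F : Type*} [CommRing F] (u v : F) :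
    (u ^ 3 - 9 * u * v ^ 2) ^ 2 + 3 * (3 * u ^ 2 * v - 3 * v ^ 3) ^ 2 = (u ^ 2 + 3 * v ^ 2) ^ 3 := by
  ring

/-- Cube roots are unique in `ℚ`: `a³ = b³ → a = b`. -/
theorem eq_of_pow_three_eq {a b : ℚ} (h : a ^ 3 = b ^ 3) : a = b := by
  have hodd : Odd 3 := by decide
  exact (hodd.strictMono_pow (R := ℚ)).injective h

/-- **`ker α̂ ⊆ φ(E(ℚ))`** [cite: Cohen2007NumberTheoryI, Prop. 8.4.4 (2), Lemma 8.4.5]. For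
`h : IsVeluThreePair m s W W'` over `ℚ` and an affine point `Q = (X, Y) ∈ W'(ℚ)`: if
`Y − θ(m(X + 4m²/3) + (27s − 4m³)/9)` is the cube of `u + vθ` (`u, v ∈ ℚ`, `θ² = −3`), that is
`u³ − 9uv² = Y` and `3u²v − 3v³ = −(m(X + 4m²/3) + (27s − 4m³)/9)`, then `Q ∈ φ(W(ℚ))`, with the
explicit preimage `(u² − (v − 2m/3)², u·(u² − (v − 2m/3)²))`. -/
theorem mem_range_pointHom_of_cube {W W' : WeierstrassCurve ℚ} {m s : ℚ}
    (h : IsVeluThreePair m s W W') {X Y : ℚ} (hQ : W'.toAffine.Nonsingular X Y) {u v : ℚ}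
    (hre : u ^ 3 - 9 * u * v ^ 2 = Y)
    (him : 3 * u ^ 2 * v - 3 * v ^ 3 = -(m * (X + 4 * m ^ 2 / 3) + (27 * s - 4 * m ^ 3) / 9)) :
    ∃ P : W.toAffine.Point, h.pointHom P = .some X Y hQ := by
  have hs : s ≠ 0 := h.s_ne
  -- the curve equation of `Q` in Cohen's coordinates
  have hE' : Y ^ 2 = (X + 4 * m ^ 2 / 3) ^ 3
      - 3 * (m * (X + 4 * m ^ 2 / 3) + (27 * s - 4 * m ^ 3) / 9) ^ 2 := by
    have := (h.equation'_iff X Y).mp hQ.left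
    linear_combination this
  -- `N(γ)³ = x̂³`, hence `N(γ) = u² + 3v² = x̂`
  have hN : u ^ 2 + 3 * v ^ 2 = X + 4 * m ^ 2 / 3 := by
    apply eq_of_pow_three_eq
    rw [← norm_cube_identity u v, hre, him]
    linear_combination hE'
  -- Lemma 8.4.5 (3): `s = -(v + m/3) x` with `x = u² - (v - 2m/3)²`
  have hsx : s = -(v + m / 3) * (u ^ 2 - (v - 2 * m / 3) ^ 2) := by
    linear_combination (1 / 3 : ℚ) * him + (m / 3) * hN
  have hvm : v + m / 3 ≠ 0 := by
    intro h0; apply hs; rw [hsx, h0]; ring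
  have hx0 : u ^ 2 - (v - 2 * m / 3) ^ 2 ≠ 0 := by
    intro h0; apply hs; rw [hsx, h0]; ring
  -- the preimage `R = (x, u x)` lies on `W`
  have hR : W.toAffine.Equation (u ^ 2 - (v - 2 * m / 3) ^ 2)
      (u * (u ^ 2 - (v - 2 * m / 3) ^ 2)) := by
    rw [h.equation_iff]
    rw [hsx]
    ring
  have hRn : W.toAffine.Nonsingular (u ^ 2 - (v - 2 * m / 3) ^ 2)
      (u * (u ^ 2 - (v - 2 * m / 3) ^ 2)) :=
    (Affine.equation_iff_nonsingular_of_Δ_ne_zero h.Δ_ne).mp hR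
  refine ⟨.some _ _ hRn, ?_⟩
  rw [IsVeluThreePair.pointHom_apply, h.pointFun_some hRn hx0]
  simp only [Affine.Point.some.injEq]
  constructor
  · -- `X(x) = x + 4ms/x + 4s²/x² = x̂ - 4m²/3 = X`
    unfold IsVeluThreePair.X
    rw [div_eq_iff (pow_ne_zero 2 hx0), hsx]
    linear_combination (u ^ 2 - (v - 2 * m / 3) ^ 2) ^ 2 * hN
  · -- `Y(x, ux) = u(u² - 9v²) = Y`
    unfold IsVeluThreePair.Y
    rw [div_eq_iff (pow_ne_zero 3 hx0), hsx, ← hre]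
    ring

/-- The same with the conclusion phrased as membership in the range of `φ`. -/
theorem some_mem_range_pointHom_of_cube {W W' : WeierstrassCurve ℚ} {m s : ℚ}
    (h : IsVeluThreePair m s W W') {X Y : ℚ} (hQ : W'.toAffine.Nonsingular X Y) {u v : ℚ}
    (hre : u ^ 3 - 9 * u * v ^ 2 = Y)
    (him : 3 * u ^ 2 * v - 3 * v ^ 3 = -(m * (X + 4 * m ^ 2 / 3) + (27 * s - 4 * m ^ 3) / 9)) :
    (Affine.Point.some X Y hQ) ∈ h.pointHom.range := by
  obtain ⟨P, hP⟩ := mem_range_pointHom_of_cube h hQ hre him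
  exact ⟨P, hP⟩

/-- For RATIONAL points of `Ê` the exceptional branch of the `Ê`-side descent value never fires:
`Y = 0 ∧ m x̂ + b̂ = 0` is impossible (it would force `x̂ = 0`, `b̂ = 0`, i.e. `27s = 4m³`). -/
theorem not_exceptional {W W' : WeierstrassCurve ℚ} {m s : ℚ} (h : IsVeluThreePair m s W W')
    {X Y : ℚ} (hQ : W'.toAffine.Nonsingular X Y) :
    ¬ (Y = 0 ∧ m * (X + 4 * m ^ 2 / 3) + (27 * s - 4 * m ^ 3) / 9 = 0) := by
  rintro ⟨hY, hmb⟩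
  have hE' : Y ^ 2 = (X + 4 * m ^ 2 / 3) ^ 3
      - 3 * (m * (X + 4 * m ^ 2 / 3) + (27 * s - 4 * m ^ 3) / 9) ^ 2 := by
    have := (h.equation'_iff X Y).mp hQ.left
    linear_combination this
  rw [hY, hmb] at hE'
  have hx : X + 4 * m ^ 2 / 3 = 0 := by
    have : (X + 4 * m ^ 2 / 3) ^ 3 = 0 := by linear_combination -hE'
    exact pow_eq_zero_iff (by norm_num) |>.mp this
  have hdisc := h.disc_ne
  by_cases hm : m = 0
  · apply hdisc
    rw [hm] at hmb ⊢
    linear_combination (-9 : ℚ) * hmb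
  · -- `x̂ = 0` and `m x̂ + b̂ = 0` give `b̂ = 0`
    apply hdisc
    rw [hx] at hmb
    linear_combination (-9 : ℚ) * hmb

end Summit.BirchSwinnertonDyer.BirchSwinnertonDyer.Rank2Observatory.ThreeIso
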